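import Mathlib.Algebra.BigOperators.Group.Finset.Powerset
import Summits.KontsevichZagierPeriods.KontsevichZagierPeriods.Theorems.ValuedFieldSpecialisationCTConstructionDilateTyped
import Summits.KontsevichZagierPeriods.KontsevichZagierPeriods.Theorems.ValuedFieldSpecialisationCTConstructionSplitTyped

/-!
# Route ValuedFieldSpecialisation — crux `CTConstruction`: one-step expansion of a dilated typed family

Helper toward crux stmt-KontsevichZagierPeriods-3495 (`CTConstruction`), line `registered`, stub
`stub_typedExpansion` of the lead's "dilation elimination". A **typed elementary family**
`R : KZ.IntegralRep (B + d + 2)` has coordinates `z = (s, u, t, w)` (`s = z 0` the parameter,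
`u = z 1`, the typed block `t : Fin B → ℝ`, `w : Fin d → ℝ`), domain `0 < s < 1`, `0 < u`,
`u ^ Q * s ^ p < 1`, `κ j * s ^ (e j) ≤ t j ≤ 1`, `w ∈ r.domain`, and integrand
`∏ (t j)⁻¹ * r.integrand w`. A family has **shape** `S ⊆ Fin B` when the positions `j ∈ S` have
type `[μ, 1]` (`κ j = μ`, `e j = 0`) and the others type `[s, 1]` (`κ j = 1`, `e j = 1`).

For a rational `0 < μ ≤ 1` and a natural `c > 0` with `c ^ Q * μ ^ p = 1` we prove the ONE-STEP
BINOMIAL LAW: the slab restriction `R'` of the Jacobian-free dilate of a family `R` of shape `S`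
satisfies `[R'] ≡ c • ∑_{T ⊇ S} [f T]` modulo FIBRED relations, for families `f T` of shape `T`:

* `stub_dilate_typedElementary`: `[R'] ≡ c • [R'']` with `R''` the typed family with lower bounds
  `μ ≤ t j` on `S` and `μ s ≤ t j` off `S`;
* `stub_split_typedElementary`, iterated over the positions off `S` (`typedExpansion_aux`, a
  Finset induction with the bookkeeping `∑_{T ⊆ insert j U} = ∑_{T ⊆ U} + ∑_{T ⊆ U} (insert j ·)`):
  a position of type `[μ s, 1]` splits at `t j = s` into one of type `[s, 1]` plus one of type
  `[μ, 1]`, so `[R''] ≡ ∑_{T' ⊆ Sᶜ} [g T']` with `g T'` of shape `S ∪ T'`;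
* reindexing `T = S ∪ T'` (`Finset.sum_nbij'`).

Sources: M. Kontsevich, D. Zagier, *Periods* (2001), §1.2 (rules (1)–(2)). No new definitions.
-/

noncomputable section

namespace Summit.KontsevichZagierPeriods.ValuedFieldSpecialisation

open Literature.NumberTheory.Transcendental Literature.NumberTheory.Transcendental.KZ

/-! ## Iterated splitting: the abstract bookkeeping -/

/-- **Iterated splitting of typed positions.** Let `D κ e` be a "domain former" indexed by
lower-bound coefficients `κ : Fin B → ℚ` and exponents `e : Fin B → ℕ`, and `I` an integrand, such
that every representation of shape `(κ, e)` with `κ j ≤ 1`, `e j = 1` splits, modulo fibred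
relations, into one of shape `(update κ j 1, e)` plus one of shape `(κ, update e j 0)`. Then a
representation `X` of shape `(κ, e)` with `κ j ≤ 1`, `e j = 1` on a finset `U` of positions expands
as `[X] ≡ ∑_{T ⊆ U} [g T]`, where `g T` has the shape obtained from `(κ, e)` by `e j := 0` on `T`
and `κ j := 1` on `U \ T` (induction on `U`, `Finset.sum_powerset_insert`). [folklore] -/
theorem typedExpansion_aux {B n : ℕ} (D : (Fin B → ℚ) → (Fin B → ℕ) → Set (Fin n → ℝ))
    (I : (Fin n → ℝ) → ℝ)
    (hsplit : ∀ (κ : Fin B → ℚ) (e : Fin B → ℕ) (j : Fin B) (X : IntegralRep n), κ j ≤ 1 →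
      e j = 1 → X.domain = D κ e → X.integrand = I → ∃ X₁ X₂ : IntegralRep n,
        X₁.domain = D (Function.update κ j 1) e ∧ X₁.integrand = I ∧
        X₂.domain = D κ (Function.update e j 0) ∧ X₂.integrand = I ∧
        of X - of X₁ - of X₂ ∈ fibredRelations)
    (U : Finset (Fin B)) :
    ∀ (κ : Fin B → ℚ) (e : Fin B → ℕ) (X : IntegralRep n), (∀ j ∈ U, κ j ≤ 1) →
      (∀ j ∈ U, e j = 1) → X.domain = D κ e → X.integrand = I →
      ∃ g : Finset (Fin B) → IntegralRep n,
        (∀ T ⊆ U, ∀ (κ' : Fin B → ℚ) (e' : Fin B → ℕ),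
          (∀ j, κ' j = if j ∈ U \ T then 1 else κ j) → (∀ j, e' j = if j ∈ T then 0 else e j) →
          (g T).domain = D κ' e' ∧ (g T).integrand = I) ∧
        of X - ∑ T ∈ U.powerset, of (g T) ∈ fibredRelations := by
  induction U using Finset.induction_on with
  | empty =>
    intro κ e X _ _ hX hXi
    refine ⟨fun _ => X, fun T hT κ' e' hκ' he' => ?_, ?_⟩
    · obtain rfl : T = ∅ := Finset.subset_empty.mp hT
      obtain rfl : κ' = κ := funext fun j => by simpa using hκ' j
      obtain rfl : e' = e := funext fun j => by simpa using he' j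
      exact ⟨hX, hXi⟩
    · rw [Finset.powerset_empty, Finset.sum_singleton, sub_self]
      exact fibredRelations.zero_mem
  | insert j U₀ hj ih =>
    intro κ e X hκ he hX hXi
    obtain ⟨X₁, X₂, hX₁, hX₁i, hX₂, hX₂i, hrel⟩ := hsplit κ e j X
      (hκ j (Finset.mem_insert_self j U₀)) (he j (Finset.mem_insert_self j U₀)) hX hXi
    -- expand `X₁` (shape `(update κ j 1, e)`) and `X₂` (shape `(κ, update e j 0)`) over `U₀`
    obtain ⟨g₁, hg₁, hrel₁⟩ := ih (Function.update κ j 1) e X₁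
      (fun j' hj' => by
        rw [Function.update_apply]
        split_ifs
        · exact le_rfl
        · exact hκ j' (Finset.mem_insert_of_mem hj'))
      (fun j' hj' => he j' (Finset.mem_insert_of_mem hj')) hX₁ hX₁i
    obtain ⟨g₂, hg₂, hrel₂⟩ := ih κ (Function.update e j 0) X₂
      (fun j' hj' => hκ j' (Finset.mem_insert_of_mem hj'))
      (fun j' hj' => by
        rw [Function.update_of_ne (ne_of_mem_of_not_mem hj' hj)]
        exact he j' (Finset.mem_insert_of_mem hj')) hX₂ hX₂i
    refine ⟨fun T => if j ∈ T then g₂ (T.erase j) else g₁ T, fun T hT κ' e' hκ' he' => ?_, ?_⟩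
    · dsimp only
      by_cases hjT : j ∈ T
      · -- the pieces containing `j` come from `X₂`
        rw [if_pos hjT]
        refine hg₂ (T.erase j) (Finset.subset_insert_iff.mp hT) κ' e' (fun j' => ?_) (fun j' => ?_)
        · rw [hκ' j']
          by_cases h : j' = j
          · subst h
            simp [hj, hjT]
          · simp [h]
        · rw [he' j']
          by_cases h : j' = j
          · subst h
            simp [hjT]
          · simp [h]
      · -- the pieces avoiding `j` come from `X₁`
        rw [if_neg hjT]
        have hT' : T ⊆ U₀ := fun x hx =>
          (Finset.mem_insert.mp (hT hx)).resolve_left fun h => hjT (h ▸ hx)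
        refine hg₁ T hT' κ' e' (fun j' => ?_) he'
        rw [hκ' j']
        by_cases h : j' = j
        · subst h
          simp [hj, hjT]
        · simp [h]
    · rw [Finset.sum_powerset_insert hj]
      have h1 : ∑ T ∈ U₀.powerset, of (if j ∈ T then g₂ (T.erase j) else g₁ T) =
          ∑ T ∈ U₀.powerset, of (g₁ T) :=
        Finset.sum_congr rfl fun T hT => by
          rw [if_neg fun h => hj (Finset.mem_powerset.mp hT h)]
      have h2 : ∑ T ∈ U₀.powerset,
          of (if j ∈ insert j T then g₂ ((insert j T).erase j) else g₁ (insert j T)) =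
          ∑ T ∈ U₀.powerset, of (g₂ T) :=
        Finset.sum_congr rfl fun T hT => by
          rw [if_pos (Finset.mem_insert_self j T),
            Finset.erase_insert fun h => hj (Finset.mem_powerset.mp hT h)]
      rw [h1, h2]
      have hsum : of X - (∑ T ∈ U₀.powerset, of (g₁ T) + ∑ T ∈ U₀.powerset, of (g₂ T)) =
          (of X - of X₁ - of X₂) + (of X₁ - ∑ T ∈ U₀.powerset, of (g₁ T)) +
            (of X₂ - ∑ T ∈ U₀.powerset, of (g₂ T)) := by
        abel
      rw [hsum]
      exact fibredRelations.add_mem (fibredRelations.add_mem hrel hrel₁) hrel₂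

/-! ## The stub -/

/-- **Stub `stub_typedExpansion` (one-step binomial law).** For a typed elementary family `R` of
shape `S` (type `[μ, 1]` on `S`, `[s, 1]` off `S`), a rational `0 < μ ≤ 1` and a natural `c > 0`
with `c ^ Q * μ ^ p = 1`, the slab restriction `R'` of the Jacobian-free dilate of `R` by `μ`
satisfies `[R'] - c • ∑_{T ⊇ S} [f T] ∈ fibredRelations` for typed elementary families `f T` of
shape `T`: dilating gives `c •` the family with lower bounds `μ` on `S` and `μ s` off `S`
(`stub_dilate_typedElementary`), and each position of type `[μ s, 1]` splits at `t j = s` into a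
position of type `[s, 1]` plus one of type `[μ, 1]` (`stub_split_typedElementary`, iterated by
`typedExpansion_aux` over `Sᶜ` and reindexed by `T = S ∪ T'`).
[Kontsevich–Zagier 2001, §1.2 rules (1)–(2)] [folklore] -/
theorem stub_typedExpansion : ∀ (Q p c B d : ℕ) (μ : ℚ) (r : Literature.NumberTheory.Transcendental.KZ.IntegralRep d) (S : Finset (Fin B)) (R R' : Literature.NumberTheory.Transcendental.KZ.IntegralRep (B + d + 1 + 1)), 0 < μ → μ ≤ 1 → 0 < c → (c : ℝ) ^ Q * (μ : ℝ) ^ p = 1 → R.domain = {z | ∃ (s u : ℝ) (t : Fin B → ℝ) (w : Fin d → ℝ), z = Matrix.vecCons s (Matrix.vecCons u (Fin.append t w)) ∧ 0 < s ∧ s < 1 ∧ 0 < u ∧ u ^ Q * s ^ p < 1 ∧ (∀ j, ((if j ∈ S then μ else 1 : ℚ) : ℝ) * s ^ (if j ∈ S then 0 else 1) ≤ t j ∧ t j ≤ 1) ∧ w ∈ r.domain} → R.integrand = (fun z => (∏ j : Fin B, (z (Fin.castAdd d j).succ.succ)⁻¹) * r.integrand (fun l : Fin d => z (Fin.natAdd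 B l).succ.succ)) → R'.domain = {z | Function.update z 0 ((μ : ℝ) * z 0) ∈ R.domain} ∩ Literature.NumberTheory.Transcendental.KZ.paramSlab (B + d + 1) 0 1 → R'.integrand = (fun z => R.integrand (Function.update z 0 ((μ : ℝ) * z 0))) → ∃ f : Finset (Fin B) → Literature.NumberTheory.Transcendental.KZ.IntegralRep (B + d + 1 + 1), (∀ T : Finset (Fin B), S ⊆ T → (f T).domain = {z | ∃ (s u : ℝ) (t : Fin B → ℝ) (w : Fin d → ℝ), z = Matrix.vecCons s (Matrix.vecCons u (Fin.append t w)) ∧ 0 < s ∧ s < 1 ∧ 0 < u ∧ u ^ Q * s ^ p < 1 ∧ (∀ j, ((if j ∈ T then μ else 1 : ℚ) : ℝ) * s ^ (if j ∈ T then 0 else 1) ≤ t j ∧ t j ≤ 1) ∧ w ∈ r.domain} ∧ (f T).integrand = (fun z => (∏ j : Fin B, (z (Fin.castAdd d j).succ.succ)⁻¹) * r.integrand (fun l : Fin d => z (Fin.natAdd B l).succ.succ))) ∧ Literature.NumberTheory.Transcendental.KZ.of R' - c • (∑ T ∈ Finset.univ.filter (fun T : Finset (Fin B) => S ⊆ T),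 Literature.NumberTheory.Transcendental.KZ.of (f T)) ∈ Literature.NumberTheory.Transcendental.KZ.fibredRelations := by
  intro Q p c B d μ r S R R' hμ hμ1 hc hcμ hR hRi hR' hR'i
  -- Step 1: dilate (`[R'] ≡ c • [R'']`, `R''` with lower bounds `μ` on `S`, `μ s` off `S`)
  obtain ⟨R'', hR''d, hR''i, hrel⟩ := stub_dilate_typedElementary Q p c B d μ
    (fun j => if j ∈ S then μ else 1) (fun j => if j ∈ S then 0 else 1) r R R' hμ hμ1 hc hcμ hR
    hRi hR' hR'i
  -- Step 2: expand the positions off `S`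
  obtain ⟨g, hg, hrelg⟩ := typedExpansion_aux
    (fun (κ : Fin B → ℚ) (e : Fin B → ℕ) => {z : Fin (B + d + 1 + 1) → ℝ | ∃ (s u : ℝ)
      (t : Fin B → ℝ) (w : Fin d → ℝ), z = Matrix.vecCons s (Matrix.vecCons u (Fin.append t w)) ∧
      0 < s ∧ s < 1 ∧ 0 < u ∧ u ^ Q * s ^ p < 1 ∧ (∀ j, ((κ j : ℚ) : ℝ) * s ^ (e j) ≤ t j ∧
      t j ≤ 1) ∧ w ∈ r.domain})
    (fun z => (∏ j : Fin B, (z (Fin.castAdd d j).succ.succ)⁻¹) *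
      r.integrand (fun l : Fin d => z (Fin.natAdd B l).succ.succ))
    (fun κ e j X hκj hej hXd hXi => stub_split_typedElementary Q p B d κ e r j X hκj hej hXd hXi)
    (Finset.univ \ S) (fun j => (if j ∈ S then μ else 1) * μ ^ (if j ∈ S then 0 else 1 : ℕ))
    (fun j => if j ∈ S then 0 else 1) R''
    (fun j hj => by
      have hjS : j ∉ S := (Finset.mem_sdiff.mp hj).2
      simp only [hjS, if_false, one_mul, pow_one]
      exact hμ1)
    (fun j hj => by
      have hjS : j ∉ S := (Finset.mem_sdiff.mp hj).2
      simp only [hjS, if_false])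
    hR''d hR''i
  -- Step 3: reindex the pieces by `T = S ∪ T'`
  refine ⟨fun T => g (T \ S), fun T hST => ?_, ?_⟩
  · refine hg (T \ S) (Finset.sdiff_subset_sdiff (Finset.subset_univ T) subset_rfl)
      (fun j => if j ∈ T then μ else 1) (fun j => if j ∈ T then 0 else 1) (fun j => ?_) (fun j => ?_)
    · by_cases hjS : j ∈ S <;> by_cases hjT : j ∈ T
      · simp [hjS, hjT]
      · exact absurd (hST hjS) hjT
      · simp [hjS, hjT]
      · simp [hjS, hjT]
    · by_cases hjS : j ∈ S <;> by_cases hjT : j ∈ T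
      · simp [hjS, hjT]
      · exact absurd (hST hjS) hjT
      · simp [hjS, hjT]
      · simp [hjS, hjT]
  · have hsum : ∑ T ∈ Finset.univ.filter (fun T : Finset (Fin B) => S ⊆ T), of (g (T \ S)) =
        ∑ T ∈ (Finset.univ \ S).powerset, of (g T) := by
      refine Finset.sum_nbij' (· \ S) (· ∪ S) (fun T _ => ?_) (fun T hT => ?_) (fun T hT => ?_)
        (fun T hT => ?_) (fun T _ => rfl)
      · exact Finset.mem_powerset.mpr (Finset.sdiff_subset_sdiff (Finset.subset_univ T) subset_rfl)
      · exact Finset.mem_filter.mpr ⟨Finset.mem_univ _, Finset.subset_union_right⟩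
      · exact Finset.sdiff_union_of_subset (Finset.mem_filter.mp hT).2
      · exact Finset.union_sdiff_cancel_right
          (Finset.disjoint_of_subset_left (Finset.mem_powerset.mp hT) Finset.sdiff_disjoint)
    show of R' - c • ∑ T ∈ Finset.univ.filter (fun T : Finset (Fin B) => S ⊆ T), of (g (T \ S)) ∈
      fibredRelations
    have hkey : of R' - c • ∑ T ∈ Finset.univ.filter (fun T : Finset (Fin B) => S ⊆ T),
        of (g (T \ S)) = (of R' - c • of R'') +
          c • (of R'' - ∑ T ∈ (Finset.univ \ S).powerset, of (g T)) := by
      rw [hsum, nsmul_sub]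
      abel
    rw [hkey]
    exact fibredRelations.add_mem hrel (fibredRelations.nsmul_mem hrelg c)

end Summit.KontsevichZagierPeriods.ValuedFieldSpecialisation
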